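import Summits.QuantumFields.YangMills.Theorems.BalabanUVNodesN15KingModelToronEffectiveLaplacian
import Summits.QuantumFields.YangMills.Theorems.BalabanUVNodesN15KingModelToronResolvent
import HarnessLib

/-!
# BalabanUVNodes ∕ N15 — THE KING-MODEL RUNG (PART Ͷ-o): KATO FOR THE BLOCK-AVERAGED TORON COVARIANCE — `|(Q^ω·B_ω⁻¹·Q^{ω*})(b,b′)| ≤ (Q·(c(−Δ)+m²)⁻¹·Q^*)(b,b′)`: the covariantly
# block-averaged toron covariance (the non-noise part of the block-field covariance `(Δ^ω_eff)⁻¹`, PART Ͷ-n) is dominated ENTRYWISE by King's `A = 0` block-averaged covariance, so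
# every `A = 0` decay bound of the rung for `Q C^η Q^*` transfers to every flat link field
# (Track A, DAG node N15 = NE2; FAN-OUT v1.1 §N15 s3 «KING-MODEL RUNG … + what the curved case adds»; count-neutral)

HONEST FRAMING.  Count-neutral (cell `pub-ymgap`, seat `pub-ymgap-dag-n15-e` g44; `--supports stmt-QuantumFields-27247 --as helper` = K3ᴬ, KEY MAP v3).  King's scalar block-spin
model [King1986] with the covariant block mean `QsOpTw` ([Balaban1985BackgroundPropagators] (3.19)) at a constant abelian (flat) link field; Kato's inequality for the fine covariance
is PART Ͱ-b ([DodziukMathai2006] Thm 1.5) at `U = toronLink ω` (PART Ͷ-b `norm_toronKernel_le_lapF_inv`); here it is pushed through the block means, whose transports are unit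
phases.  NOT Bałaban's `G_k(U)`; NOT a node discharge; nothing continuum-YM ∕ ℝ⁴ ∕ OS ∕ Clay.

THE RESULTS (unit `ω`, `c ≥ 0`, `m² > 0`; `Q^ω = QsOpTw N M ω`, `Q = QsOp N M` (B5 (1.20)), `B_ω = toronOp (fine N M) c m² ω`, `G = (lapF (fine N M) c m²)⁻¹`):
* `norm_twPow` (`|ω^j| = 1`), `norm_QsOpTw_apply_le` (`|Q^ω(b,x)| ≤ |Q(b,x)|`, indeed `=`), `norm_kingQadjTw_apply_le`; `norm_toronOp_inv_apply_le` (Ͷ-b∕Ͱ-b at the fine torus);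
* ★★★ **`norm_blockAvg_toron_le`** — `|(Q^ωB_ω⁻¹Q^{ω*})(b,b′)| ≤ Σ_{x,y}|Q(b,x)|·G(x,y)·|Q^{*}(y,b′)|` =: the `A = 0` block-averaged covariance with absolute block weights (`= N^{d+1}(Q·G·Qᴴ)(b,b′)`
  since King's weights are non-negative): THE NON-NOISE PART OF THE TORON BLOCK-FIELD COVARIANCE IS DOMINATED BY KING's;
* (with PART Ͷ-n's `(Δ^ω_eff)⁻¹ = a⁻¹·1 + Q^ωB_ω⁻¹Q^{ω*}` this bounds the toron block-field covariance entrywise by `a⁻¹[b = b′]` plus the dominating `A = 0` kernel.)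

PRIOR TREE ART (by name): Ͷ-k (`effLapTw_eq_inv`, `kingQadjTw`, `fineOpTw`), Ͷ-b (`norm_toronKernel_le_lapF_inv` via `toronOp_inv_apply_eq`… used through `norm_toronOp_inv_le`), Ͷ-f∕Ͱ-b (Kato),
`B5ToronOperators118` (`QsOpTw`, `twPow`), `B5Block118` (`QsOp`), `King1986.Torus.lapF`.  Dedup (rg at filing): basename 0 files; needles `norm_blockAvg_toron_le|norm_QsOpTw_apply_le|norm_twPow|norm_QsOp_apply`
0 tree files.  Locators: [King1986] (2.10) p.652, (2.13)–(2.15) p.653, (4.4) p.670; [Balaban1985BackgroundPropagators] (3.19) p.393, (3.23) p.394; [DodziukMathai2006] §1 Thm 1.5; [tHooft1979Flux]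
NPB 153 (notion only).  0 `sorry`, 0 `def`.
-/

noncomputable section

open scoped BigOperators ComplexConjugate ComplexOrder
open Finset Matrix Complex

namespace Summit.QuantumFields.YangMills.BalabanUVNodes.N15KingModelRung.Toron

open Literature.MathematicalPhysics.QuantumFieldTheory.Balaban1983to89.B5Prop11Plancherel
open Literature.MathematicalPhysics.QuantumFieldTheory.Balaban1983to89.B5Block118 (QsOp bpt)
open Literature.MathematicalPhysics.QuantumFieldTheory.Balaban1983to89.B5ToronOperators118 (QsOpTw twPow)
open Literature.MathematicalPhysics.QuantumFieldTheory.King1986.Torus (lapF)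

variable {d : ℕ} (N : ℕ) [NeZero N] (M : Fin (d + 1) → ℕ) [hM : ∀ μ, NeZero (M μ)]

omit [NeZero N] hM in
/-- The block transport is a unit phase: `|ω^j| = 1` for unit `ω`. [cite: Balaban1985BackgroundPropagators, (3.19) p.393] -/
theorem norm_twPow {ω : Fin (d + 1) → ℂ} (hω : ∀ μ, ‖ω μ‖ = 1) (j : Fin (d + 1) → Fin N) : ‖twPow N ω j‖ = 1 := by
  rw [twPow, norm_prod, Finset.prod_eq_one fun ν _ => by rw [norm_pow, hω, one_pow]]

omit [NeZero N] hM in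
/-- The flat block mean's entries are non-negative reals: `‖Q(b,x)‖ = Σ_j [x = ny + j]∕N^{d+1}`. [cite: Balaban1984PropagatorsI, (1.20) p.20] -/
theorem norm_QsOp_apply (b : Tor M) (x : Tor (fine N M)) :
    ‖QsOp N M b x‖ = ∑ j : Fin (d + 1) → Fin N, (if x = bpt N M b j then 1 / (N : ℝ) ^ (d + 1) else 0) := by
  have h : QsOp N M b x = ((∑ j : Fin (d + 1) → Fin N, (if x = bpt N M b j then 1 / (N : ℝ) ^ (d + 1) else 0) : ℝ) : ℂ) := by
    unfold QsOp
    push_cast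
    refine Finset.sum_congr rfl fun j _ => ?_
    split_ifs <;> simp
  rw [h, Complex.norm_real, Real.norm_eq_abs, abs_of_nonneg (Finset.sum_nonneg fun j _ => by split_ifs <;> positivity)]

omit [NeZero N] hM in
/-- `|Q^ω(b,x)| ≤ |Q(b,x)|`: the covariant block mean's entries are the flat ones times unit phases. [cite: Balaban1985BackgroundPropagators, (3.19) p.393; Balaban1984PropagatorsI, (1.20) p.20] -/
theorem norm_QsOpTw_apply_le {ω : Fin (d + 1) → ℂ} (hω : ∀ μ, ‖ω μ‖ = 1) (b : Tor M) (x : Tor (fine N M)) : ‖QsOpTw N M ω b x‖ ≤ ‖QsOp N M b x‖ := by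
  rw [norm_QsOp_apply]
  unfold QsOpTw
  refine le_trans (norm_sum_le _ _) (le_of_eq (Finset.sum_congr rfl fun j _ => ?_))
  split_ifs with h
  · rw [norm_div, norm_twPow N hω, Complex.norm_pow, Complex.norm_natCast]
  · rw [norm_zero]

omit [NeZero N] hM in
/-- The same for King's adjoint: `|Q^{ω*}(y,b′)| ≤ N^{d+1}|Q(b′,y)|`. [cite: King1986, (2.10) p.652] -/
theorem norm_kingQadjTw_apply_le {ω : Fin (d + 1) → ℂ} (hω : ∀ μ, ‖ω μ‖ = 1) (y : Tor (fine N M)) (b : Tor M) :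
    ‖kingQadjTw N M ω y b‖ ≤ (N : ℝ) ^ (d + 1) * ‖QsOp N M b y‖ := by
  rw [kingQadjTw, Matrix.smul_apply, smul_eq_mul, norm_mul, Matrix.conjTranspose_apply, Complex.star_def, Complex.norm_conj, Complex.norm_pow, Complex.norm_natCast]
  exact mul_le_mul_of_nonneg_left (norm_QsOpTw_apply_le N M hω b y) (by positivity)

/-- Kato at the fine torus (PART Ͷ-b at `K = fine N M`): `|B_ω⁻¹(x,y)| ≤ G(x,y)`. [cite: DodziukMathai2006, §1 Thm 1.5; King1986, (4.4) p.670] -/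
theorem norm_toronOp_fine_inv_apply_le {c m2 : ℝ} (hc : 0 ≤ c) (hm : 0 < m2) (φ : Fin (d + 1) → ℝ) (x y : Tor (fine N M)) :
    ‖(toronOp (fine N M) c m2 (Literature.MathematicalPhysics.QuantumFieldTheory.Balaban1983to89.B5ToronMomentum161.twistOf φ))⁻¹ x y‖ ≤ (lapF (fine N M) c m2)⁻¹ x y := by
  rw [toronOp_inv_apply_eq (fine N M) hc hm]
  exact norm_toronKernel_le_lapF_inv (fine N M) hc hm φ x y

/-- ★★★ **KATO FOR THE BLOCK-AVERAGED TORON COVARIANCE**: for `ω = e^{iφ}`, `c ≥ 0`, `m² > 0`,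
`|(Q^ω·B_ω⁻¹·Q^{ω*})(b,b′)| ≤ N^{d+1}·Σ_xΣ_y |Q(b,x)|·G(x,y)·|Q(b′,y)|` — the non-noise part of the toron block-field covariance is dominated entrywise by King's `A = 0` block-averaged
covariance (absolute block weights; King's weights are non-negative). [cite: DodziukMathai2006, §1 Thm 1.5; King1986, (2.13)-(2.15) p.653; Balaban1985BackgroundPropagators, (3.19) p.393] -/
theorem norm_blockAvg_toron_le {c m2 : ℝ} (hc : 0 ≤ c) (hm : 0 < m2) (φ : Fin (d + 1) → ℝ) (b b' : Tor M) :
    ‖(QsOpTw N M (Literature.MathematicalPhysics.QuantumFieldTheory.Balaban1983to89.B5ToronMomentum161.twistOf φ)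
        * (toronOp (fine N M) c m2 (Literature.MathematicalPhysics.QuantumFieldTheory.Balaban1983to89.B5ToronMomentum161.twistOf φ))⁻¹
        * kingQadjTw N M (Literature.MathematicalPhysics.QuantumFieldTheory.Balaban1983to89.B5ToronMomentum161.twistOf φ)) b b'‖
      ≤ (N : ℝ) ^ (d + 1) * ∑ y, ∑ x, ‖QsOp N M b x‖ * (lapF (fine N M) c m2)⁻¹ x y * ‖QsOp N M b' y‖ := by
  have hω := norm_twistOf_eq_one φ
  set ω := Literature.MathematicalPhysics.QuantumFieldTheory.Balaban1983to89.B5ToronMomentum161.twistOf φ with hωdef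
  set B := (toronOp (fine N M) c m2 ω)⁻¹ with hB
  have hG : ∀ x y, 0 ≤ (lapF (fine N M) c m2)⁻¹ x y := fun x y => le_trans (norm_nonneg _) (norm_toronOp_fine_inv_apply_le N M hc hm φ x y)
  calc ‖(QsOpTw N M ω * B * kingQadjTw N M ω) b b'‖
      = ‖∑ y, (∑ x, QsOpTw N M ω b x * B x y) * kingQadjTw N M ω y b'‖ := by simp only [Matrix.mul_apply]
    _ ≤ ∑ y, ‖(∑ x, QsOpTw N M ω b x * B x y) * kingQadjTw N M ω y b'‖ := norm_sum_le _ _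
    _ ≤ ∑ y, (∑ x, ‖QsOpTw N M ω b x‖ * ‖B x y‖) * ‖kingQadjTw N M ω y b'‖ := Finset.sum_le_sum fun y _ => by
        rw [norm_mul]
        exact mul_le_mul_of_nonneg_right ((norm_sum_le _ _).trans (le_of_eq (Finset.sum_congr rfl fun x _ => norm_mul _ _))) (norm_nonneg _)
    _ ≤ ∑ y, (∑ x, ‖QsOp N M b x‖ * (lapF (fine N M) c m2)⁻¹ x y) * ((N : ℝ) ^ (d + 1) * ‖QsOp N M b' y‖) := Finset.sum_le_sum fun y _ => by
        refine mul_le_mul (Finset.sum_le_sum fun x _ => mul_le_mul (norm_QsOpTw_apply_le N M hω b x) ?_ (norm_nonneg _) (norm_nonneg _))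
          (norm_kingQadjTw_apply_le N M hω y b') (norm_nonneg _) (Finset.sum_nonneg fun x _ => mul_nonneg (norm_nonneg _) (hG x y))
        rw [hB, hωdef]; exact norm_toronOp_fine_inv_apply_le N M hc hm φ x y
    _ = (N : ℝ) ^ (d + 1) * ∑ y, ∑ x, ‖QsOp N M b x‖ * (lapF (fine N M) c m2)⁻¹ x y * ‖QsOp N M b' y‖ := by
        rw [Finset.mul_sum]
        refine Finset.sum_congr rfl fun y _ => ?_
        rw [Finset.sum_mul, Finset.mul_sum]
        exact Finset.sum_congr rfl fun x _ => by ring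

end Summit.QuantumFields.YangMills.BalabanUVNodes.N15KingModelRung.Toron

end
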